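import Summits.ResolutionOfSingularities.ResolutionOfSingularities.Theorems.RadicialJungCleanModelsCcurvePersistUpstairs
import Summits.ResolutionOfSingularities.ResolutionOfSingularities.Theorems.RadicialJungCleanModelsCcurvePersistPack
import HarnessLib

/-!
# Route `RadicialJung`, crux `CleanModels` (stmt-15917) — (C-curve) sub-line: closed-point persist, ONE curve factor (core of `stub_Cc_persistForm3`, case `m = 1` of `stub_Cc_persistForm1`)

Lead `res-B-lead-1` g7 (plan `Cruxes/CleanModels/Lines/Sketch-memo-Ccurve-plan.md` §1 S5; workfile `Lines/Sketch_Ccurve_assembly.lean` v2.8).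
OURS · counted 0.  Nothing here proves resolution in characteristic `p`; resolution in char `p` is NOT proved.

`persist_one_core`: in the output situation of the centre-curve node (`S' = locAtCentre B' O` regular of dimension 3, r.s.p. `(x, y, z)`, `(x, y)` the centre of
the coarsening `O₁`), a representative `Σ c_j^p g₀^j = A₀ · (x α + y β)^{a₀}` with `A₀` a `v₁`-unit of `S'`, `(α, β)` a row of `S'` not inside `(x, y) × (x, y)`
(the curve factor is a regular parameter of `S'_{(x,y)}`) and `p ∤ a₀` becomes loosely clean of FORM (1) on a model obtained by point blow-ups along `O`:
✓ `row_decomp` (order `e`), ✓ `exists_eq_unit_mul_pow_add_K` (order `e_a` of `A₀`), ✓ `pointPrep_weak` with `n = e_a + e`, ✓ `lift_term`/`lift_row`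
(`A₀ = z^{e_a}·unit`, `x α + y β = z^{n+e} ℓ`, `ℓ = u x_n + v y_n` with `(u, v)` unimodular, so `(z, ℓ, y_n)` or `(z, ℓ, x_n)` is an r.s.p.), ✓ `pack_one`.
-/

noncomputable section

set_option linter.dupNamespace false

open IsLocalRing Literature.AlgebraicGeometry.Resolution
open Summit.ResolutionOfSingularities.ResolutionOfSingularities.Theorems

namespace Summit.ResolutionOfSingularities.ResolutionOfSingularities.Theorems.RadicialJung.CleanModels.Ccurve

variable {K : Type} [Field K]

/-- Change of r.s.p.: if `ℓ = u x_n + v y_n` with `u` a unit of the subring `R ⊆ K`, then `(x_n, y_n, z)` and `(z, ℓ, y_n)` generate the same ideal. [folklore] -/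
theorem span_triple_of_comb {R : Subring K} {xn yn z u v ℓ : K} (hxn : xn ∈ R) (hyn : yn ∈ R) (hz : z ∈ R) (hu : u ∈ R) (hv : v ∈ R)
    (huinv : u⁻¹ ∈ R) (hu0 : u ≠ 0) (hℓm : ℓ ∈ R) (hℓ : ℓ = u * xn + v * yn) :
    Ideal.span ({⟨xn, hxn⟩, ⟨yn, hyn⟩, ⟨z, hz⟩} : Set ↥R) = Ideal.span {⟨z, hz⟩, ⟨ℓ, hℓm⟩, ⟨yn, hyn⟩} := by
  have hxn_eq : (⟨xn, hxn⟩ : ↥R) = ⟨u⁻¹, huinv⟩ * ⟨ℓ, hℓm⟩ + ⟨-(u⁻¹ * v), R.neg_mem (R.mul_mem huinv hv)⟩ * ⟨yn, hyn⟩ := by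
    apply Subtype.ext
    change xn = u⁻¹ * ℓ + -(u⁻¹ * v) * yn
    rw [hℓ]; field_simp; ring
  have hℓ_eq : (⟨ℓ, hℓm⟩ : ↥R) = ⟨u, hu⟩ * ⟨xn, hxn⟩ + ⟨v, hv⟩ * ⟨yn, hyn⟩ := by
    apply Subtype.ext
    change ℓ = u * xn + v * yn
    exact hℓ
  apply le_antisymm
  · rw [Ideal.span_le, Set.insert_subset_iff, Set.insert_subset_iff, Set.singleton_subset_iff]
    refine ⟨?_, Ideal.subset_span (by simp), Ideal.subset_span (by simp)⟩
    rw [SetLike.mem_coe, hxn_eq]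
    exact Ideal.add_mem _ (Ideal.mul_mem_left _ _ (Ideal.subset_span (by simp))) (Ideal.mul_mem_left _ _ (Ideal.subset_span (by simp)))
  · rw [Ideal.span_le, Set.insert_subset_iff, Set.insert_subset_iff, Set.singleton_subset_iff]
    refine ⟨Ideal.subset_span (by simp), ?_, Ideal.subset_span (by simp)⟩
    rw [SetLike.mem_coe, hℓ_eq]
    exact Ideal.add_mem _ (Ideal.mul_mem_left _ _ (Ideal.subset_span (by simp))) (Ideal.mul_mem_left _ _ (Ideal.subset_span (by simp)))

/-- **Closed-point persist, one curve factor (core).**  See the module docstring. [folklore] -/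
theorem persist_one_core {k : Type} [Field k] [Algebra k K] (p : ℕ) (hp : p.Prime)
    (O : ValuationSubring K) (A : Subalgebra k K) (hAO : A.toSubring ≤ O.toSubring) (hAfg : A.FG) [IsFractionRing A K]
    (hdimA : ringKrullDim A ≤ 3)
    (hzd : ∀ (T : Subring K) (hT : T ≤ O.toSubring), A.toSubring ≤ T → (subringCentre T O hT).IsMaximal)
    (B' : Subalgebra k K) (hB'O : B'.toSubring ≤ O.toSubring) (hAB' : A ≤ B') (hB'fg : B'.FG)
    (hB'reg : IsRegularLocalRing (locAtCentre B'.toSubring O)) (hB'dim : ringKrullDim (locAtCentre B'.toSubring O) = 3)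
    (O₁ : ValuationSubring K) (hOO₁ : O ≤ O₁)
    (x y z : K) (hx : x ∈ locAtCentre B'.toSubring O) (hy : y ∈ locAtCentre B'.toSubring O) (hz : z ∈ locAtCentre B'.toSubring O)
    (hmax : (haveI := isLocalRing_locAtCentre hB'O; IsLocalRing.maximalIdeal (locAtCentre B'.toSubring O)) =
        Ideal.span {⟨x, hx⟩, ⟨y, hy⟩, ⟨z, hz⟩})
    (hcen : ∀ w : ↥(locAtCentre B'.toSubring O), O₁.valuation (w : K) < 1 ↔
        w ∈ Ideal.span {(⟨x, hx⟩ : ↥(locAtCentre B'.toSubring O)), ⟨y, hy⟩})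
    (g₀ : K) (c : Fin p → K) (hc : ∃ j : Fin p, (j : ℕ) ≠ 0 ∧ c j ≠ 0)
    (A₀ α β : K) (hA₀ : A₀ ∈ locAtCentre B'.toSubring O) (hvA₀ : O₁.valuation A₀ = 1)
    (hα : α ∈ locAtCentre B'.toSubring O) (hβ : β ∈ locAtCentre B'.toSubring O) (htr : O₁.valuation α = 1 ∨ O₁.valuation β = 1)
    (a₀ : ℕ) (ha₀ : ¬ p ∣ a₀)
    (hG : (∑ j : Fin p, c j ^ p * g₀ ^ (j : ℕ)) = A₀ * (x * α + y * β) ^ a₀) :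
    ∃ (A' : Subalgebra k K), A'.toSubring ≤ O.toSubring ∧ A ≤ A' ∧ A'.FG ∧
    ∃ (_ : IsRegularLocalRing ↥(locAtCentre A'.toSubring O)) (c : Fin p → K), (∃ j : Fin p, (j : ℕ) ≠ 0 ∧ c j ≠ 0) ∧
    ((∃ (d m : ℕ) (hmd : m ≤ d) (t : Fin d → ↥(locAtCentre A'.toSubring O)) (a : Fin m → ℕ) (u : ↥(locAtCentre A'.toSubring O)), IsUnit u ∧
    Ideal.span (Set.range t) = IsLocalRing.maximalIdeal ↥(locAtCentre A'.toSubring O) ∧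
    ringKrullDim ↥(locAtCentre A'.toSubring O) = (d : WithBot ℕ∞) ∧ 0 < m ∧ (∀ i, ¬ p ∣ a i) ∧
    (∑ j : Fin p, c j ^ p * g₀ ^ (j : ℕ)) = (u : K) * ∏ i : Fin m, ((t (Fin.castLE hmd i) : ↥(locAtCentre A'.toSubring O)) : K) ^ (a i)) ∨
    (∃ u : ↥(locAtCentre A'.toSubring O), IsUnit u ∧ (∑ j : Fin p, c j ^ p * g₀ ^ (j : ℕ)) = (u : K) ∧
    ∀ c' : ↥(locAtCentre A'.toSubring O), u - c' ^ p ∉ IsLocalRing.maximalIdeal ↥(locAtCentre A'.toSubring O)) ∨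
    (∃ s c' : ↥(locAtCentre A'.toSubring O), (∑ j : Fin p, c j ^ p * g₀ ^ (j : ℕ)) = (s : K) ∧
    s - c' ^ p ∈ IsLocalRing.maximalIdeal ↥(locAtCentre A'.toSubring O) ∧
    s - c' ^ p ∉ IsLocalRing.maximalIdeal ↥(locAtCentre A'.toSubring O) ^ 2)) := by
  classical
  haveI := isLocalRing_locAtCentre hB'O
  haveI : IsRegularLocalRing ↥(locAtCentre B'.toSubring O) := hB'reg
  obtain ⟨hvz₁, hvx₁, hvy₁⟩ := valuation_coarse_z_eq_one hB'O hOO₁ hB'dim hx hy hz hmax hcen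
  have hz0 : z ≠ 0 := ne_zero_of_valuation_eq_one hvz₁
  -- orders of `A₀` and of the row `(α, β)`
  obtain ⟨ea, Ua, c₁, c₂, hUa, hc₁, hc₂, hvUa, hA₀eq⟩ := exists_eq_unit_mul_pow_add_K hB'O hOO₁ hB'dim hx hy hz hmax hcen hA₀ hvA₀
  obtain ⟨e, a', b', a₁, a₂, b₁, b₂, ha', hb', ha₁, ha₂, hb₁, hb₂, hαeq, hβeq, huni⟩ :=
    row_decomp hB'O hOO₁ hB'dim hx hy hz hmax hcen hα hβ htr
  -- `n = ea + e` point blow-ups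
  obtain ⟨B'', hB''O, hAB'', hB''fg, hB''reg, hB''dim, hSS, h₁, h₂, h₃, hmax''⟩ :=
    pointPrep_weak k K O A hAO hAfg ‹_› hdimA hzd B' hB'O hAB' hB'fg hB'reg hB'dim O₁ hOO₁ x y z hx hy hz hmax hcen (ea + e)
  haveI := isLocalRing_locAtCentre hB''O
  set xn : K := x / z ^ (ea + e) with hxn
  set yn : K := y / z ^ (ea + e) with hyn
  have hxe : x = xn * z ^ (ea + e) := by rw [hxn]; field_simp
  have hye : y = yn * z ^ (ea + e) := by rw [hyn]; field_simp
  obtain ⟨hvxn, hvyn, hvz⟩ := valuation_lt_one_of_gen hB''O h₁ h₂ h₃ hmax''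
  have hRO : locAtCentre B''.toSubring O ≤ O.toSubring := locAtCentre_le hB''O
  -- lift `A₀` and the row
  obtain ⟨Wa, hWa, hA₀up, hWa1, -⟩ := lift_term (O := O) hRO h₃ h₁ h₂ (hSS hUa) (hSS hc₁) (hSS hc₂) hvxn hvyn
    (Nat.le_add_right ea e) hxe hye
  have hvWa : O.valuation Wa = 1 := hWa1 hvUa
  obtain ⟨u, v, hu, hv, hrow, hu1, -, hv1, -⟩ := lift_row (O := O) hRO h₃ h₁ h₂ (hSS ha') (hSS hb') (hSS ha₁) (hSS ha₂) (hSS hb₁) (hSS hb₂)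
    hvxn hvyn (Nat.le_add_left e ea) hxe hye
  set ℓ : K := u * xn + v * yn with hℓ
  have hℓm : ℓ ∈ locAtCentre B''.toSubring O := Subring.add_mem _ (Subring.mul_mem _ hu h₁) (Subring.mul_mem _ hv h₂)
  -- the representative upstairs
  have hG' : (∑ j : Fin p, c j ^ p * g₀ ^ (j : ℕ)) = Wa * z ^ (ea + (ea + e + e) * a₀) * ℓ ^ a₀ := by
    rw [hG, hA₀eq, hαeq, hβeq, hA₀up, hrow, mul_pow, ← pow_mul]; ring
  rcases huni with ha'1 | hb'1
  · -- `u` is a unit: r.s.p. `(z, ℓ, y_n)`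
    have hvu : O.valuation u = 1 := hu1 ha'1
    have hu0 : u ≠ 0 := ne_zero_of_valuation_eq_one hvu
    have huinv : u⁻¹ ∈ locAtCentre B''.toSubring O := inv_mem_locAtCentre hu hvu
    have hmaxℓ : maximalIdeal ↥(locAtCentre B''.toSubring O) = Ideal.span {⟨z, h₃⟩, ⟨ℓ, hℓm⟩, ⟨yn, h₂⟩} := by
      rw [hmax'', span_triple_of_comb h₁ h₂ h₃ hu hv huinv hu0 hℓm hℓ]
    exact pack_one p hp O A B'' hB''O hAB'' hB''fg hB''reg hB''dim g₀ z ℓ yn Wa h₃ hℓm h₂ hWa hvWa hz0 hmaxℓ c hc _ a₀ ha₀ hG'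
  · -- `v` is a unit: r.s.p. `(z, ℓ, x_n)`
    have hvv : O.valuation v = 1 := hv1 hb'1
    have hv0 : v ≠ 0 := ne_zero_of_valuation_eq_one hvv
    have hvinv : v⁻¹ ∈ locAtCentre B''.toSubring O := inv_mem_locAtCentre hv hvv
    have hmax₂ : maximalIdeal ↥(locAtCentre B''.toSubring O) = Ideal.span {⟨yn, h₂⟩, ⟨xn, h₁⟩, ⟨z, h₃⟩} := by
      rw [hmax'', Set.insert_comm]
    have hmaxℓ : maximalIdeal ↥(locAtCentre B''.toSubring O) = Ideal.span {⟨z, h₃⟩, ⟨ℓ, hℓm⟩, ⟨xn, h₁⟩} := by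
      rw [hmax₂, span_triple_of_comb h₂ h₁ h₃ hv hu hvinv hv0 hℓm (by rw [hℓ]; ring)]
    exact pack_one p hp O A B'' hB''O hAB'' hB''fg hB''reg hB''dim g₀ z ℓ xn Wa h₃ hℓm h₁ hWa hvWa hz0 hmaxℓ c hc _ a₀ ha₀ hG'

end Summit.ResolutionOfSingularities.ResolutionOfSingularities.Theorems.RadicialJung.CleanModels.Ccurve

end
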